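import Summits.QuantumFields.BalabanUV.Beta.D1BFx.GhostTwoPointBubbleSum
import Summits.QuantumFields.BalabanUV.Beta.D1BFx.GhostBubbleRestSplit
import Summits.QuantumFields.BalabanUV.Beta.D1BFx.GhostCurrentRealised
import Summits.QuantumFields.BalabanUV.Beta.D1BFx.GluonBubbleTails

/-!
# `BalabanUV.Beta.D1BFx.GhostBubbleTailsII` — road «BF-x» for binder row D1, END-ii row «L-GBUB-ii» PART 4 (the J-twin of `GluonBubbleTails`):
# THE THREE GRADED KIN × KIN GHOST-BUBBLE WORDS OF THE END AT THE REGRADED GHOST PROFILE `v ↦ n⁻²·gfrz n a b v` (END-ii, form F1),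
# `τ = inr³ (inl (0,0,r,r′))`, `(r,r′) ≠ (0,0)`, bounded uniformly in the scale under hω′ ∧ hlam, MODULO [B5, Prop. 1.2] ∕ [B5, (1.126)–(1.127)] BY NAME

HONEST DEPENDENCY (page 1, mandatory): continuum YM on T⁴ ⇐ BetaPertH ∧ nine spine estimates (0/9 proved); BetaPertH ⇐ (D1) ∧ (D4) ∧
CAP+tail; G-an2-4 gates asym, D1 and NE2/3/4.  HONEST FRAMING (cell contract, verbatim): «discharging `BetaPertH` makes Bałaban's UV
stability UNCONDITIONAL — a real constructive-QFT result; it is NOT the continuum limit and NOT the Clay problem.»  THIS MODULE DISCHARGES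
NOTHING of the wall by itself: it proves the three `hGbub` clauses of the END (`RoadEndBFxWired.d1Drift_BFx_of_prop12_of_rows` :142–146) IN THEIR END-ii
FORM (owner ruling ρ-g11-9 ∕ `END-ii-SPEC.md` v1: `hω ↦ hω′`, ghost words at the regraded profile) as [folklore] compositions BY NAME of PART 3
`GhostTwoPointBubbleSum` with the HYPOTHESIS-FREE ghost-leg rows `GhostLegFree.ghost_d0∕d1` and the frozen profile's rows `FrozenLegTails.gfrz_rows_d0_d1_of_prop12`
— CONDITIONAL on the two printed statements [B5, Prop. 1.2 (1.110)–(1.114)] (`B5.Prop12Printed`) and [B5, (1.126)–(1.127)] (`B5.Kernel126_127Printed`) taken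
BY NAME exactly as the END displays them — and `FrozenLegProfile` (h0∕h1, evenness), the word algebra of `SplitRecut.restK'_gbub` ∕ `GhostBubbleRestSplit` ∕
`GhostCurrentRealised.ghCur_eq_realK` ∕ `BiBubbleTable.biBubble_realK_realK`.  No `def`, no `Prop` minted, nothing cited anew, 0 sorry.  END-ii itself (the
owner's (a)∕(b): `main_table₂`, the chain twins) is NOT in the tree; this file supplies its L-GBUB row in advance, against EXISTING names.  0 wall binders
discharged; NOT (K), NOT D1, NOT `BetaPertH`, NOT continuum, NOT Clay.

ABSOLUTE RULE (cell charter, verbatim): «No internally-minted statement may enter as a cited fact. Every hypothesis is either kernel-proved in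
this package or a verbatim quotation of a PUBLISHED theorem with page reference. The manuscript(s) under audit are NOT citable for their own
disputed steps — they are the thing under adjudication; programme-internal (2001/route/tribunal) claims are never citable.»

WHY (owner d1-p2-g11 RULING ρ-g11-9 (3)(c) + ACK 15:11Z (c) «L-GBUB-ii FIRST REFUSAL GRANTED … F2-shape `n²Ggh − fL` + `ghost_h0`»; `END-ii-SPEC.md` v1 §2 (Δ1)(Δ2),
§3(c); this lineage's located finding F-gan24leaf05-g41-1 (under reading (i) the graded ghost words carry `4N²·c_gh·log n`) and STATEMENT «L-GBUB-ii»
`CLAIMS.log` 2026-08-21T15:34:42Z): `SplitRecut.restK'_gbub` displays the word at `τ = inr³ (inl (0,0,r,r′))` as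
`ωgh·cK·cK·n⁻⁸·w_μw_ν·baseKer (biBubbleTable (ghLeg r) (ghLeg r′) ghCur ghCur μ ν) b w`; at the regraded profile `ghLeg n a (n⁻²g) = n⁻² • P` with
`P₀ = frozenLeg g`, `P₁ = n²•Ggh − frozenLeg g` (the RIGHT small grade: `n²Ggh − gfrz = (n²Ggh − gFree) − (gfrz − gFree)`, both `O(n⁻²)`-flat with `O(n⁻³)` steps);
`GhostBubbleRestSplit.biBubbleTable_smul_legs` pulls `n⁻⁴` out; `ghCur = realK (ghostStn · 1)` makes the table `−½·bub₂ P_r P_r′ (b+w) b (ghostStn μ 1) (ghostStn ν 1)`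
(gradings 1, 1); PART 3 bounds its weighted full sum by `A` uniformly in `n ≥ 1` and `b`; `|ωgh·cK²|·n⁻⁸·n⁻⁴ = 4N²` under hω′ ∧ hlam; the weights `n⁻⁴` sum to one.
* §1 [folklore] `ghLeg_regrade` (`ghLeg n a (n⁻²g) r = n⁻² • P_r`), `baseKer_ghostTable_regrade_eq` (the table as `n⁻⁴·(−½)·bub₂`), **`restK'_gbub_ii_eq`** (the word).
* §2 [folklore] `ghWeight_eq_of_hω'_hlam` (`|ωgh·(cK·cK)|·n⁻⁸·(n⁻²·n⁻²) = 4N²`), `ghA0_nonneg`, `ghA1_nonneg`.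
* §3 [folklore] **`hGbub_ii_of_prop12`**: for every `(r, r′) ≠ (0, 0)`,
  `∃ C ≥ 0, ∀ n ≥ 2, |Σ_{b ∈ image resSite} n⁻⁴·fullSum (w ↦ restK' n a (v ↦ n⁻²·gfrz n a b v) … (n⁸) N μ ν b (inr³ (inl (0,0,r,r′))) w)| ≤ C` — the 3 L-GBUB-ii rows;
  **`hGbub_s_of_prop12`** — the same in the owner's one-scalar «ENDₛ» shape (ρ-g11-11 (3), WORDS 15:46Z): profile `fun v => s n * gfrz n a b v`, pin
  `hs : s n = n⁻²`, tie `hω_s`; `hGbub_smul_of_prop12` — idem with the profile spelled `s n • gfrz n a b`.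
NOT HERE (honest): END-ii's main-term identity and chain twins (owner (a)∕(b)); T₄–T₇-ii; L-GTAD-ii; any statement under the END's `hω` (reading (i)).
Unit `b2b-balaban-gan24-formalise-leaf-05` (gen 44), G-an2-4 swarm leaf seat on road «BF-x» at the OWNER's grant (ρ-g11-9 (3)(c)); `LEAVES-BFx.md` row «L-GBUB-ii» PART 4.
-/

noncomputable section

namespace Summit.QuantumFields.BalabanUV.Beta.D1BFx.GhostBubbleTailsII

open Finset Filter Topology
open scoped BigOperators
open Literature.MathematicalPhysics.QuantumFieldTheory.Balaban1983to89
open Literature.MathematicalPhysics.QuantumFieldTheory.Balaban1983to89.Beta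
open ExpKernelCalculus (Site MKer)
open DyadicShell (Pt toReal supNorm)
open BubbleTransfer (unitVec)
open GhostTable (gFree)
open MomentTransferPeriodic (baseKer)
open WindowIdentification (psum fullSum fullSum_const_mul)
open DressedMomentNormalisation (resSite)
open GradedBubbles (Graded)
open LongitudinalWindow (ellD0 ellD1)
open WoodburyCovariant (woodburyDc woodburyD1c)
open B6QGQDecay237 (deltaU deltaU_pos)
open PointColumnSplit (cG0 cG0_nonneg cSplit cSplit_nonneg)
open PointColumnDecay (cFar cFar_pos)
open Summit.QuantumFields.BalabanUV.Beta.VecTableZ4 (ghostStn graded_ghostStn)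
open Summit.QuantumFields.BalabanUV.Beta.D1BFx.PackedKernelSplit (biBubble)
open Summit.QuantumFields.BalabanUV.Beta.D1BFx.BiBubbleTable (bub₂ biBubble_realK_realK)
open Summit.QuantumFields.BalabanUV.Beta.D1BFx.FineHessianSectors (biBubbleTable biBubbleTable_apply)
open Summit.QuantumFields.BalabanUV.Beta.D1BFx.FineHessianLegGrades (frozenLeg)
open Summit.QuantumFields.BalabanUV.Beta.D1BFx.FineHessianGhostGrades (ghSec ghWt ghLeg)
open Summit.QuantumFields.BalabanUV.Beta.D1BFx.GhostLeg (Ggh Ggh_symm)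
open Summit.QuantumFields.BalabanUV.Beta.D1BFx.GhostStencil (ghCur)
open Summit.QuantumFields.BalabanUV.Beta.D1BFx.GhostCurrentRealised (ghCur_eq_realK)
open Summit.QuantumFields.BalabanUV.Beta.D1BFx.GhostLegFree (ghDelta ghDelta_pos ghA0 ghA1 ghost_d0 ghost_d1)
open Summit.QuantumFields.BalabanUV.Beta.D1BFx.GhostBubbleRestSplit (biBubbleTable_smul_legs)
open Summit.QuantumFields.BalabanUV.Beta.D1BFx.Assembly (sum_uniform_resSite uniform_resSite_nonneg)
open Summit.QuantumFields.BalabanUV.Beta.D1BFx.ContactCount (abs_sum_mul_le_of_convex)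
open Summit.QuantumFields.BalabanUV.Beta.D1BFx.GluonBubbleTails (row_mono)
open Summit.QuantumFields.BalabanUV.Beta.D1BFx.ReducedKernel (TableR)
open Summit.QuantumFields.BalabanUV.Beta.D1BFx.SplitRecut (restK' restK'_gbub)
open Summit.QuantumFields.BalabanUV.Beta.D1BFx.FrozenLegProfile (gfrz gfrz_neg abs_gfrz_sub_gFree_le abs_gfrz_diff_flat_le)
open Summit.QuantumFields.BalabanUV.Beta.D1BFx.FrozenLegTails (nOf MOf hn1 gfrz_rows_d0_d1_of_prop12)
open Summit.QuantumFields.BalabanUV.Beta.D1BFx.GhostTwoPointBubbleSum (exists_bound_fullSum_moment_bub₂)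
open VectorTailsLoc (fam kfam)

/-! ## §1 The word at the regraded profile as a weighted `bub₂` through the regraded pieces -/

section Word

variable (n : ℕ) [NeZero n] (a : ℝ) (g : Pt → ℝ) (cE cΛ cR cK cQ cE₂ cJ4 cΛ₂ cR₂ cQ₂ x₀ : ℝ) (WE WJ WΛ WR WQ : TableR)
  (ωgl ωgh lam N : ℝ) (μ ν : Fin 4) (b : Pt)

/-- [folklore] **THE REGRADE OF THE GHOST LEG PIECES**: `ghLeg n a (n⁻²·g) r = n⁻² • (n² • ghLeg n a (n⁻²·g) r)` (a scalar identity, `n ≠ 0`). -/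
theorem ghLeg_regrade (r : Fin 2) : ghLeg n a (fun v => ((n : ℝ) ^ 2)⁻¹ * g v) r = ((n : ℝ) ^ 2)⁻¹ • ((n : ℝ) ^ 2 • ghLeg n a (fun v => ((n : ℝ) ^ 2)⁻¹ * g v) r) := by
  have hn : ((n : ℝ) ^ 2) ≠ 0 := pow_ne_zero 2 (Nat.cast_ne_zero.mpr (NeZero.ne n))
  rw [inv_smul_smul₀ hn]

/-- [folklore] **THE KIN × KIN GHOST TABLE AT THE REGRADED PROFILE IS `n⁻⁴·(−½)·bub₂` THROUGH THE REGRADED PIECES** and an3's once-differenced ghost lists: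
`baseKer (biBubbleTable (ghLeg r) (ghLeg r′) ghCur ghCur μ ν) b w = n⁻²·n⁻²·(−½·bub₂ P_r P_r′ (b + w) b (ghostStn μ 1) (ghostStn ν 1))`. -/
theorem baseKer_ghostTable_regrade_eq (r r' : Fin 2) (w : Pt) :
    baseKer (biBubbleTable (ghLeg n a (fun v => ((n : ℝ) ^ 2)⁻¹ * g v) r) (ghLeg n a (fun v => ((n : ℝ) ^ 2)⁻¹ * g v) r') (ghSec n 0) (ghSec n 0) μ ν) b w =
      ((n : ℝ) ^ 2)⁻¹ * ((n : ℝ) ^ 2)⁻¹ *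
        (-(1 / 2 : ℝ) * bub₂ ((n : ℝ) ^ 2 • ghLeg n a (fun v => ((n : ℝ) ^ 2)⁻¹ * g v) r) ((n : ℝ) ^ 2 • ghLeg n a (fun v => ((n : ℝ) ^ 2)⁻¹ * g v) r') (b + w) b (ghostStn μ (1 : Matrix Unit Unit ℝ)) (ghostStn ν (1 : Matrix Unit Unit ℝ))) := by
  conv_lhs => rw [ghLeg_regrade n a g r, ghLeg_regrade n a g r']
  simp only [baseKer]
  rw [biBubbleTable_smul_legs, biBubbleTable_apply, show ghSec n 0 = ghCur from rfl, ghCur_eq_realK, ghCur_eq_realK, biBubble_realK_realK]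

variable {g} in
/-- [folklore] **THE END-ii GHOST-BUBBLE WORD AS A WEIGHTED TWO-LEG TABLE**: at `τ = inr³ (inl (0, 0, r, r'))`, `(r, r') ≠ (0, 0)`, profile `n⁻²·g`,
`restK' … b τ w = (ωgh·(cK·cK)·n⁻⁸·(n⁻²·n⁻²)·(−½)) · (w_μ w_ν · bub₂ P_r P_r′ (b + w) b (ghostStn μ 1) (ghostStn ν 1))`. -/
theorem restK'_gbub_ii_eq {r r' : Fin 2} (hrr : ¬(r = 0 ∧ r' = 0)) :
    (fun w : Pt => restK' n a (fun v => ((n : ℝ) ^ 2)⁻¹ * g v) cE cΛ cR cK cQ cE₂ cJ4 cΛ₂ cR₂ cQ₂ x₀ WE WJ WΛ WR WQ ωgl ωgh lam N μ ν b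
        (Sum.inr (Sum.inr (Sum.inr (Sum.inl ((0 : Fin 2), (0 : Fin 2), r, r'))))) w) =
      fun w : Pt => (ωgh * (cK * cK) * ((n : ℝ) ^ 8)⁻¹ * (((n : ℝ) ^ 2)⁻¹ * ((n : ℝ) ^ 2)⁻¹) * (-(1 / 2 : ℝ))) * (toReal w μ * toReal w ν *
        bub₂ ((n : ℝ) ^ 2 • ghLeg n a (fun v => ((n : ℝ) ^ 2)⁻¹ * g v) r) ((n : ℝ) ^ 2 • ghLeg n a (fun v => ((n : ℝ) ^ 2)⁻¹ * g v) r') (b + w) b (ghostStn μ (1 : Matrix Unit Unit ℝ)) (ghostStn ν (1 : Matrix Unit Unit ℝ))) := by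
  funext w
  rw [restK'_gbub]
  have hne : ((0 : Fin 2), (0 : Fin 2), r, r') ≠ ((0 : Fin 2), (0 : Fin 2), (0 : Fin 2), (0 : Fin 2)) := by
    intro h
    simp only [Prod.mk.injEq, true_and] at h
    exact hrr h
  rw [if_neg hne]
  dsimp only
  rw [show ghWt cK cQ 0 = cK from rfl, baseKer_ghostTable_regrade_eq]
  ring

end Word

/-! ## §2 The weight under hω′ ∧ hlam; the ghost row constants are nonnegative -/

/-- [folklore] **THE END-ii GHOST-BUBBLE WEIGHT IS `4N²`, n-FREE**: under `hlam : ωgl·cE² = 2N²·n⁸` and the physical tie `hω′ : ωgh·cK² = −2·(ωgl·cE²)·n⁴`,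
`|ωgh·(cK·cK)|·n⁻⁸·(n⁻²·n⁻²) = 4N²`. -/
theorem ghWeight_eq_of_hω'_hlam {n : ℕ} (hn : n ≠ 0) {ωgl ωgh cE cK N : ℝ} (hlam : ωgl * cE ^ 2 = 2 * N ^ 2 * (n : ℝ) ^ 8)
    (hω' : ωgh * cK ^ 2 = -2 * (ωgl * cE ^ 2) * (n : ℝ) ^ 4) :
    |ωgh * (cK * cK)| * ((n : ℝ) ^ 8)⁻¹ * (((n : ℝ) ^ 2)⁻¹ * ((n : ℝ) ^ 2)⁻¹) = 4 * N ^ 2 := by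
  have hn0 : (0 : ℝ) < (n : ℝ) := by exact_mod_cast Nat.pos_of_ne_zero hn
  rw [← sq, hω', hlam, show -2 * (2 * N ^ 2 * (n : ℝ) ^ 8) * (n : ℝ) ^ 4 = -(4 * N ^ 2 * (n : ℝ) ^ 12) by ring, abs_neg,
    abs_of_nonneg (by positivity)]
  field_simp

/-- [folklore] The ghost leg's d0 constant is nonnegative. -/
theorem ghA0_nonneg {a : ℝ} (ha : 0 < a) : 0 ≤ ghA0 a := by
  have h1 := cG0_nonneg 4
  have h2 := cSplit_nonneg 4 ha
  have h3 := cFar_pos 4 ha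
  have h4 := deltaU_pos 4 ha
  unfold ghA0
  positivity

/-- [folklore] The ghost leg's d1 constant is nonnegative. -/
theorem ghA1_nonneg {a : ℝ} (ha : 0 < a) : 0 ≤ ghA1 a := by
  have h1 := GhostLegFree.cG1_spec.1
  have h2 := cSplit_nonneg 4 ha
  have h3 := cFar_pos 4 ha
  have h4 := deltaU_pos 4 ha
  unfold ghA1
  positivity

/-! ## §3 The three L-GBUB-ii clauses of the END -/

section End

variable {a : ℝ} {cE cΛ cR cK cQ cE₂ cJ4 cΛ₂ cR₂ cQ₂ x₀ ωgl ωgh : ℕ → ℝ} {WE WJ WΛ WR WQ : ℕ → TableR} {N : ℝ} {μ ν : Fin 4}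

/-- [folklore] **«L-GBUB-ii» — THE THREE GRADED KIN × KIN GHOST-BUBBLE CLAUSES OF THE END IN THEIR END-ii FORM** (`τ = inr³ (inl (0, 0, r, r'))`,
`(r, r') ≠ (0, 0)`: the leg-graded ghost bubble words over the KIN sectors) FOR THE REGRADED FROZEN PROFILE `v ↦ n⁻²·gfrz n a b v`, MODULO
[B5, Prop. 1.2 (1.110)–(1.114)] AND [B5, (1.126)–(1.127)] BY NAME (`h12`∕`h126`, exactly as the END displays them: used ONLY for the rows of `gfrz`) AND THE
END's `hlam` WITH THE PHYSICAL TIE hω′ (`END-ii-SPEC.md` v1 (Δ1)): `∃ C ≥ 0, ∀ n ≥ 2, |Σ_{b ∈ image resSite} n⁻⁴·fullSum (w ↦ restK' n a (n⁻²·gfrz_b) … (n⁸) N μ ν b τ w)| ≤ C`.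
DEPENDENCE: `C = 4N²·½·A(a, δ, A₀, A₁, D₀, D₁; r, r')` with `δ = min (ghDelta a) δ₂`, `A_j = max (ghA_j a) G_j'` the common constants of the HYPOTHESIS-FREE rows of
`n²·Ggh` (`GhostLegFree`) and the rows of `gfrz`, `D₀ = woodburyDc 0 + ellD0 4 a`, `D₁ = woodburyD1c 0 + ellD1 4 a`; no `n`, no `b`, no `μ, ν`; NO `hKray`, NO pin,
NO `h2s`∕`d2s`.  Under the END's own `hω` (reading (i)) these words are NOT n-uniformly bounded (F-gan24leaf05-g41-1); this is the reading-(ii) row. -/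
theorem hGbub_ii_of_prop12 (ha : 0 < a) (h12 : B5.Prop12Printed (fam nOf hn1 MOf a ha)) (h126 : B5.Kernel126_127Printed (kfam nOf MOf))
    (hlam : ∀ n : ℕ, 2 ≤ n → ωgl n * cE n ^ 2 = 2 * N ^ 2 * (n : ℝ) ^ 8)
    (hω' : ∀ n : ℕ, 2 ≤ n → ωgh n * cK n ^ 2 = -2 * (ωgl n * cE n ^ 2) * (n : ℝ) ^ 4)
    (r r' : Fin 2) (hrr : ¬(r = 0 ∧ r' = 0)) :
    ∃ C : ℝ, 0 ≤ C ∧ ∀ n : ℕ, 2 ≤ n → ∀ [NeZero n],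
      |∑ b ∈ (univ : Finset (Fin 4 → Fin n)).image resSite, ((n : ℝ) ^ 4)⁻¹ *
        fullSum (fun w : Pt => restK' n a (fun v => ((n : ℝ) ^ 2)⁻¹ * gfrz n a b v) (cE n) (cΛ n) (cR n) (cK n) (cQ n) (cE₂ n) (cJ4 n) (cΛ₂ n)
          (cR₂ n) (cQ₂ n) (x₀ n) (WE n) (WJ n) (WΛ n) (WR n) (WQ n) (ωgl n) (ωgh n) ((n : ℝ) ^ 8) N μ ν b
            (Sum.inr (Sum.inr (Sum.inr (Sum.inl ((0 : Fin 2), (0 : Fin 2), r, r'))))) w)| ≤ C := by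
  -- the rows, with common constants
  obtain ⟨δ₂, G₀', G₁', hδ₂, hG₀, hG₁, d0, d1⟩ := gfrz_rows_d0_d1_of_prop12 ha h12 h126
  have hgd := ghDelta_pos ha
  have hgA0 := ghA0_nonneg ha
  have hgA1 := ghA1_nonneg ha
  have hD₀ : 0 ≤ woodburyDc 0 + ellD0 4 a := add_nonneg VectorLegVolumeAdapter.woodburyDc_zero_nonneg (OffDiagonalLegGrade.ellD0_nonneg ha)
  have hD₁ : 0 ≤ woodburyD1c 0 + ellD1 4 a := add_nonneg VectorLegVolumeAdapter.woodburyD1c_zero_nonneg (OffDiagonalLegGrade.ellD1_nonneg ha)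
  have hδ : 0 < min (ghDelta a) δ₂ := lt_min hgd hδ₂
  obtain ⟨A, hA, h⟩ := exists_bound_fullSum_moment_bub₂ (a := a) (graded_ghostStn μ (1 : Matrix Unit Unit ℝ)) (graded_ghostStn ν (1 : Matrix Unit Unit ℝ))
    le_rfl (by norm_num) r r' hrr ha hδ (le_max_of_le_left hgA0 : (0 : ℝ) ≤ max (ghA0 a) G₀') (le_max_of_le_left hgA1 : (0 : ℝ) ≤ max (ghA1 a) G₁') hD₀ hD₁
  refine ⟨4 * N ^ 2 * ((1 / 2 : ℝ) * A), by positivity, fun n hn _ => ?_⟩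
  have hn1 : 1 ≤ n := le_trans one_le_two hn
  have hn0 : n ≠ 0 := by omega
  have hw : |ωgh n * (cK n * cK n)| * ((n : ℝ) ^ 8)⁻¹ * (((n : ℝ) ^ 2)⁻¹ * ((n : ℝ) ^ 2)⁻¹) = 4 * N ^ 2 := ghWeight_eq_of_hω'_hlam hn0 (hlam n hn) (hω' n hn)
  refine abs_sum_mul_le_of_convex _ (fun b hb => uniform_resSite_nonneg n b hb) (sum_uniform_resSite hn0) fun b _ => ?_
  -- the rows at scale `n`, base point `b`
  have e0 : ∀ (x v : Pt), v ≠ 0 → |(n : ℝ) ^ 2 * Ggh n a (x + v) x () ()| ≤ max (ghA0 a) G₀' * Real.exp (-(min (ghDelta a) δ₂ / n) * supNorm v) / (supNorm v : ℝ) ^ 2 :=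
    fun x v hv => row_mono (min_le_left _ _) (le_max_left _ _) hgA0 (ghost_d0 n ha x v hv)
  have e1 : ∀ (x v : Pt), v ≠ 0 → ∀ ρ : Fin 4, |(n : ℝ) ^ 2 * Ggh n a (x + (v + unitVec ρ)) x () () - (n : ℝ) ^ 2 * Ggh n a (x + v) x () ()| ≤
      max (ghA1 a) G₁' * Real.exp (-(min (ghDelta a) δ₂ / n) * supNorm v) / (supNorm v : ℝ) ^ 3 :=
    fun x v hv ρ => row_mono (min_le_left _ _) (le_max_left _ _) hgA1 (ghost_d1 n ha x v hv ρ)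
  have g0 : ∀ v : Pt, v ≠ 0 → |gfrz n a b v| ≤ max (ghA0 a) G₀' * Real.exp (-(min (ghDelta a) δ₂ / n) * supNorm v) / (supNorm v : ℝ) ^ 2 :=
    fun v hv => row_mono (min_le_right _ _) (le_max_right _ _) hG₀ (d0 n b v hv)
  have g1 : ∀ v : Pt, v ≠ 0 → ∀ ρ : Fin 4, |gfrz n a b (v + unitVec ρ) - gfrz n a b v| ≤
      max (ghA1 a) G₁' * Real.exp (-(min (ghDelta a) δ₂ / n) * supNorm v) / (supNorm v : ℝ) ^ 3 :=
    fun v hv ρ => row_mono (min_le_right _ _) (le_max_right _ _) hG₁ (d1 n b v hv ρ)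
  obtain ⟨⟨L, hL⟩, hb'⟩ := h n hn1 (gfrz n a b) (fun w => gfrz_neg w) e0 e1 g0 g1 (fun v => abs_gfrz_sub_gFree_le n hn1 ha b v)
    (fun v ρ => abs_gfrz_diff_flat_le n hn1 ha b v ρ) b μ ν
  rw [restK'_gbub_ii_eq n a (cE n) (cΛ n) (cR n) (cK n) (cQ n) (cE₂ n) (cJ4 n) (cΛ₂ n) (cR₂ n) (cQ₂ n) (x₀ n) (WE n) (WJ n) (WΛ n) (WR n) (WQ n)
    (ωgl n) (ωgh n) ((n : ℝ) ^ 8) N μ ν b hrr, fullSum_const_mul _ ⟨L, hL⟩, abs_mul, ← hw]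
  have hκ : |ωgh n * (cK n * cK n) * ((n : ℝ) ^ 8)⁻¹ * (((n : ℝ) ^ 2)⁻¹ * ((n : ℝ) ^ 2)⁻¹) * (-(1 / 2 : ℝ))| =
      |ωgh n * (cK n * cK n)| * ((n : ℝ) ^ 8)⁻¹ * (((n : ℝ) ^ 2)⁻¹ * ((n : ℝ) ^ 2)⁻¹) * (1 / 2 : ℝ) := by
    rw [abs_mul, abs_mul, abs_mul, abs_of_nonneg (by positivity : (0 : ℝ) ≤ ((n : ℝ) ^ 8)⁻¹),
      abs_of_nonneg (by positivity : (0 : ℝ) ≤ ((n : ℝ) ^ 2)⁻¹ * ((n : ℝ) ^ 2)⁻¹), show |(-(1 / 2 : ℝ))| = 1 / 2 by norm_num]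
  rw [hκ, mul_assoc]
  exact mul_le_mul_of_nonneg_left (mul_le_mul_of_nonneg_left hb' (by norm_num)) (by positivity)

/-- [folklore] **«L-GBUB-ii» IN THE OWNER's ONE-SCALAR «ENDₛ» SHAPE** (ruling ρ-g11-11 (3) + WORDS 15:46Z (1): displayed `s : ℕ → ℝ`, pin
`hs : s n = n⁻²`, tie `hω_s : ωgh n * (s n * cK n) ^ 2 = -2 * (ωgl n * cE n ^ 2)`, ghost rest profile `fun v => s n * gfrz n a b v` — `s n • gfrz n a b` unfolds to it
by `Pi.smul_apply`): the same three clauses, by rewriting to `hGbub_ii_of_prop12`.  The pin is load-bearing: at `s ≡ 1` (= reading (i)) the words carry `log n`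
(F-gan24leaf05-g41-1). -/
theorem hGbub_s_of_prop12 (ha : 0 < a) (h12 : B5.Prop12Printed (fam nOf hn1 MOf a ha)) (h126 : B5.Kernel126_127Printed (kfam nOf MOf))
    (hlam : ∀ n : ℕ, 2 ≤ n → ωgl n * cE n ^ 2 = 2 * N ^ 2 * (n : ℝ) ^ 8) (s : ℕ → ℝ) (hs : ∀ n : ℕ, 2 ≤ n → s n = ((n : ℝ) ^ 2)⁻¹)
    (hω_s : ∀ n : ℕ, 2 ≤ n → ωgh n * (s n * cK n) ^ 2 = -2 * (ωgl n * cE n ^ 2))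
    (r r' : Fin 2) (hrr : ¬(r = 0 ∧ r' = 0)) :
    ∃ C : ℝ, 0 ≤ C ∧ ∀ n : ℕ, 2 ≤ n → ∀ [NeZero n],
      |∑ b ∈ (univ : Finset (Fin 4 → Fin n)).image resSite, ((n : ℝ) ^ 4)⁻¹ *
        fullSum (fun w : Pt => restK' n a (fun v => s n * gfrz n a b v) (cE n) (cΛ n) (cR n) (cK n) (cQ n) (cE₂ n) (cJ4 n) (cΛ₂ n)
          (cR₂ n) (cQ₂ n) (x₀ n) (WE n) (WJ n) (WΛ n) (WR n) (WQ n) (ωgl n) (ωgh n) ((n : ℝ) ^ 8) N μ ν b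
            (Sum.inr (Sum.inr (Sum.inr (Sum.inl ((0 : Fin 2), (0 : Fin 2), r, r'))))) w)| ≤ C := by
  have hω' : ∀ n : ℕ, 2 ≤ n → ωgh n * cK n ^ 2 = -2 * (ωgl n * cE n ^ 2) * (n : ℝ) ^ 4 := by
    intro n hn
    have hn0 : ((n : ℝ) ^ 2) ≠ 0 := pow_ne_zero 2 (by exact_mod_cast (show n ≠ 0 by omega))
    have h := hω_s n hn
    rw [hs n hn] at h
    have e : ωgh n * cK n ^ 2 = ωgh n * (((n : ℝ) ^ 2)⁻¹ * cK n) ^ 2 * (n : ℝ) ^ 4 := by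
      field_simp
    rw [e, h]
  obtain ⟨C, hC, h⟩ := hGbub_ii_of_prop12 (cΛ := cΛ) (cR := cR) (cQ := cQ) (cE₂ := cE₂) (cJ4 := cJ4) (cΛ₂ := cΛ₂) (cR₂ := cR₂) (cQ₂ := cQ₂) (x₀ := x₀)
    (WE := WE) (WJ := WJ) (WΛ := WΛ) (WR := WR) (WQ := WQ) (μ := μ) (ν := ν) ha h12 h126 hlam hω' r r' hrr
  refine ⟨C, hC, fun n hn _ => ?_⟩
  simp only [hs n hn]
  exact h n hn

/-- [folklore] … and with the profile written as the `Pi`-scalar multiple `s n • gfrz n a b` (ρ-g11-11 (3)'s spelling; definitionally the same function). -/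
theorem hGbub_smul_of_prop12 (ha : 0 < a) (h12 : B5.Prop12Printed (fam nOf hn1 MOf a ha)) (h126 : B5.Kernel126_127Printed (kfam nOf MOf))
    (hlam : ∀ n : ℕ, 2 ≤ n → ωgl n * cE n ^ 2 = 2 * N ^ 2 * (n : ℝ) ^ 8) (s : ℕ → ℝ) (hs : ∀ n : ℕ, 2 ≤ n → s n = ((n : ℝ) ^ 2)⁻¹)
    (hω_s : ∀ n : ℕ, 2 ≤ n → ωgh n * (s n * cK n) ^ 2 = -2 * (ωgl n * cE n ^ 2))
    (r r' : Fin 2) (hrr : ¬(r = 0 ∧ r' = 0)) :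
    ∃ C : ℝ, 0 ≤ C ∧ ∀ n : ℕ, 2 ≤ n → ∀ [NeZero n],
      |∑ b ∈ (univ : Finset (Fin 4 → Fin n)).image resSite, ((n : ℝ) ^ 4)⁻¹ *
        fullSum (fun w : Pt => restK' n a (s n • gfrz n a b) (cE n) (cΛ n) (cR n) (cK n) (cQ n) (cE₂ n) (cJ4 n) (cΛ₂ n)
          (cR₂ n) (cQ₂ n) (x₀ n) (WE n) (WJ n) (WΛ n) (WR n) (WQ n) (ωgl n) (ωgh n) ((n : ℝ) ^ 8) N μ ν b
            (Sum.inr (Sum.inr (Sum.inr (Sum.inl ((0 : Fin 2), (0 : Fin 2), r, r'))))) w)| ≤ C :=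
  hGbub_s_of_prop12 ha h12 h126 hlam s hs hω_s r r' hrr

end End

end Summit.QuantumFields.BalabanUV.Beta.D1BFx.GhostBubbleTailsII

end
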